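import Summits.QuantumFields.YangMills.Theorems.PencilRigidityWeakCouplingHypercubicLimitStubCountertermBoundOfSkewFloor
import HarnessLib

/-!
# `WeakCouplingHypercubicLimit` — counterterm bound under the ORDER-ONE moment hypothesis (line `Sketch`)

Crux `stmt-QuantumFields-16120` (`PencilRigidity.WeakCouplingHypercubicLimit`), line `Sketch`
(`trace-norm-cold-pressure`), sub-goals `countertermBound_of_momentOne_ntFloor` and
`countertermBound_of_momentOne_skewFloor`: **the additive counterterms of the curvature are bounded**,
`∃ Cm, ∀ k, |m_k| ≤ Cm`, given only the `k`-uniform ORDER-ONE anisotropic moment bound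
`∃ s C, ∀ F, normP s F ≤ 1 → ∀ k, |∫ Φ^P_k(F) dμ_k| ≤ C` (weaker than `UniformMomentBoundsPlanes r sch`,
which is the all-orders `C₀ C₁ⁿ n!` version) together with the two-point non-triviality floor
`δ ≤ |LS₂(u, v) − LS₁(u) LS₁(v)|` resp. the third-cumulant floor
`δ ≤ |LS₃(f,g,h) − LS₁(f)LS₂(g,h) − LS₁(g)LS₂(f,h) − LS₁(h)LS₂(f,g) + 2 LS₁(f)LS₁(g)LS₁(h)|`, eventually in `k`.

Route (the sister stubs `stub_countertermBound` / `stub_countertermBoundOfSkewFloor`, whose proofs use the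
all-orders hypothesis only at `n = 1`).
1. Either floor pins `|c_k| ≥ c₀ > 0` eventually (`eventually_le_abs_c_of_ntFloor`: the truncated two-point
   bound `LatticeTruncatedTwoPointBound` and the mesh-uniform Riemann bounds `exists_latticeSum_le` give
   `δ ≤ c_k² D`; `eventually_le_abs_c_of_skewFloor`: `abs_conn_three_le` gives `δ ≤ |c_k|³ D`).
2. The order-one bound on the single-plane tuple `Pi.single q f` (`fieldP_single`, `normP_single`) is
   `|∫ Φ^{q}_k(f) dμ_k| ≤ C` for `|f|_s ≤ 1` (`abs_integral_planeField_le_of_momentOne`).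
3. `countertermBound_of_cFloor`: on the normalised plateau bump `f = t f₀` (`exists_bump_schwartz`),
   `|c_k| R_k (|m_k/6| − B_w) ≤ C` (`abs_c_mul_riemann_mul_sub_le`) with `R_k = a_k⁴ Σₓ f(a_k x) ≥ t/16`
   eventually (`pow_le_sum_box`), whence `|m_k| ≤ 6 (B_w + C/(c₀ t/16))` eventually; finitely many earlier
   `k` are absorbed (`exists_forall_abs_le_of_eventually`). [folklore]
-/

noncomputable section

open scoped SchwartzMap
open MeasureTheory Filter Topology
open Literature.MathematicalPhysics.AQFT Literature.MathematicalPhysics.QuantumLattice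
  Literature.MathematicalPhysics.QuantumFieldTheory
open Literature.Probability.LatticeModels (Site box mem_box)
open Summit.QuantumFields.YangMills.Cruxes.HypercubicLimit.CouplingResponse
open Summit.QuantumFields.YangMills.Theorems.CurvatureKernel (LatticeTruncatedTwoPointBound)
open Summit.QuantumFields.YangMills.Theorems.OSLegsFromFemtoAndGap.StubLower
  (pow_le_sum_box exists_bump_schwartz)

namespace Summit.QuantumFields.YangMills.Theorems.WeakCouplingHypercubicLimit.TraceNormColdPressure

section Lattice

variable {G : Type} [Group G] [TopologicalSpace G] [IsTopologicalGroup G] [CompactSpace G]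
  [MeasurableSpace G] [BorelSpace G]

/-- **The order-one moment bound on one plane**: if `|∫ Φ^P_k(F) dμ_k| ≤ C` for every 6-tuple `F` with
`normP s F ≤ 1`, then `|∫ Φ^{q}_k(f) dμ_k| ≤ C` for `|f|_s ≤ 1` (the single-plane tuple `Pi.single q f`).
[folklore] -/
theorem abs_integral_planeField_le_of_momentOne (r : LatticeRep G) (sch : SpeciesScheme (YMSpecies G))
    {s : ℕ} {C : ℝ}
    (hM : ∀ F : Plane → 𝓢(EuclideanSpace ℝ (Fin 4), ℝ), normP s F ≤ 1 →
      ∀ k : ℕ, |∫ U, fieldP r sch k F U ∂(wilsonAt r sch k)| ≤ C)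
    (q : Plane) {f : 𝓢(EuclideanSpace ℝ (Fin 4), ℝ)} (hf : schwartzNorm s (ofRealTest f) ≤ 1)
    (k : ℕ) : |∫ U, planeField r sch k q f U ∂(wilsonAt r sch k)| ≤ C := by
  have h := hM (Pi.single q f) (by rw [normP_single]; exact hf) k
  simpa only [fieldP_single] using h

/-- **The counterterm bound from a `c`-floor and a one-plane bound.** If `|∫ Φ^{q}_k(f) dμ_k| ≤ C` for all
planes `q`, all `|f|_s ≤ 1` and all `k`, and `|c_k| ≥ c₀ > 0` eventually, then `∃ Cm, ∀ k, |m_k| ≤ Cm`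
(plateau bump, `abs_c_mul_riemann_mul_sub_le`, `pow_le_sum_box`). [folklore] -/
theorem countertermBound_of_cFloor (r : LatticeRep G) (sch : SpeciesScheme (YMSpecies G)) {s : ℕ}
    {C : ℝ}
    (hP : ∀ (q : Plane) (f : 𝓢(EuclideanSpace ℝ (Fin 4), ℝ)), schwartzNorm s (ofRealTest f) ≤ 1 →
      ∀ k : ℕ, |∫ U, planeField r sch k q f U ∂(wilsonAt r sch k)| ≤ C)
    {c₀ : ℝ} (hc₀ : 0 < c₀) (hc : ∀ᶠ k in atTop, c₀ ≤ |sch.c r.curvature k|) :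
    ∃ Cm : ℝ, ∀ k, |sch.m r.curvature k| ≤ Cm := by
  -- adapted from `stub_countertermBound` (PencilRigidityWeakCouplingHypercubicLimitStubCountertermBound.lean)
  -- the normalised plateau bump `f = t • f₀`
  obtain ⟨f₀, hf₀0, -, hf₀1, -, -⟩ := exists_bump_schwartz (0 : EuclideanSpace ℝ (Fin 4)) one_pos
  have hN₀ : 0 ≤ schwartzNorm s (ofRealTest f₀) := schwartzNorm_nonneg _ _
  set t : ℝ := 1 / (1 + schwartzNorm s (ofRealTest f₀)) with ht
  have ht0 : 0 < t := by positivity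
  set f : 𝓢(EuclideanSpace ℝ (Fin 4), ℝ) := t • f₀ with hf
  have hf_apply : ∀ y, f y = t * f₀ y := fun y => by rw [hf, smul_apply, smul_eq_mul]
  have hf0 : ∀ y, 0 ≤ f y := fun y => by rw [hf_apply]; exact mul_nonneg ht0.le (hf₀0 y)
  have hfnorm : schwartzNorm s (ofRealTest f) ≤ 1 := by
    rw [hf, schwartzNorm_ofRealTest_smul, abs_of_pos ht0, ht, div_mul_eq_mul_div, one_mul,
      div_le_one (by positivity)]
    linarith
  -- constants
  set q₀ : Plane := ⟨(0, 1), by decide⟩ with hq₀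
  obtain ⟨Bw, hBw⟩ := (planeSpecies r q₀).bounded
  have hPf : ∀ k, |∫ U, planeField r sch k q₀ f U ∂(wilsonAt r sch k)| ≤ C := fun k =>
    hP q₀ f hfnorm k
  have hC : 0 ≤ C := (abs_nonneg _).trans (hPf 0)
  have hkey : ∀ k, |sch.c r.curvature k| *
      (sch.a k ^ 4 * ∑ x ∈ box 4 (sch.L k), f (sch.a k • siteToE x)) *
        (|sch.m r.curvature k / 6| - Bw) ≤ C := fun k =>
    abs_c_mul_riemann_mul_sub_le r sch q₀ hBw hf0 k (hPf k)
  -- eventual smallness of the mesh and largeness of the box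
  have hev_a : ∀ᶠ k in atTop, sch.a k ≤ 1 / 2 :=
    sch.tendsto_a.eventually (eventually_le_nhds (by norm_num))
  have hev_aL : ∀ᶠ k in atTop, (1 : ℝ) ≤ sch.a k * sch.L k :=
    sch.tendsto_L.eventually (eventually_ge_atTop 1)
  -- the Riemann mass of the plateau: `R_k ≥ t / 16` eventually
  have hevR : ∀ᶠ k in atTop,
      t / 16 ≤ sch.a k ^ 4 * ∑ x ∈ box 4 (sch.L k), f (sch.a k • siteToE x) := by
    filter_upwards [hev_a, hev_aL] with k ha haL
    have hak := sch.a_pos k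
    have hpl : (1 / (2 * sch.a k)) ^ 4 ≤ ∑ y ∈ box 4 (sch.L k), f₀ (sch.a k • siteToE y) :=
      pow_le_sum_box (g := ⇑f₀) (p := 0) (ρ := 1) hf₀0 hak (fun z hz => hf₀1 z hz) (by linarith)
        fun j => by simpa using haL
    have h16 : sch.a k ^ 4 * (1 / (2 * sch.a k)) ^ 4 = 1 / 16 := by
      field_simp
      ring
    have hsum : sch.a k ^ 4 * ∑ x ∈ box 4 (sch.L k), f (sch.a k • siteToE x) =
        t * (sch.a k ^ 4 * ∑ x ∈ box 4 (sch.L k), f₀ (sch.a k • siteToE x)) := by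
      rw [Finset.mul_sum, Finset.mul_sum, Finset.mul_sum]
      refine Finset.sum_congr rfl fun x _ => ?_
      rw [hf_apply]; ring
    rw [hsum]
    calc t / 16 = t * (sch.a k ^ 4 * (1 / (2 * sch.a k)) ^ 4) := by rw [h16]; ring
      _ ≤ t * (sch.a k ^ 4 * ∑ y ∈ box 4 (sch.L k), f₀ (sch.a k • siteToE y)) :=
          mul_le_mul_of_nonneg_left (mul_le_mul_of_nonneg_left hpl (by positivity)) ht0.le
  -- the eventual bound on the counterterm
  set x₀ : ℝ := c₀ * (t / 16) with hx₀
  have hx₀pos : 0 < x₀ := by positivity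
  have hevM : ∀ᶠ k in atTop, |sch.m r.curvature k| ≤ 6 * (Bw + C / x₀) := by
    filter_upwards [hc, hevR] with k hck hkR
    have hX : x₀ ≤ |sch.c r.curvature k| *
        (sch.a k ^ 4 * ∑ x ∈ box 4 (sch.L k), f (sch.a k • siteToE x)) :=
      mul_le_mul hck hkR (by positivity) (abs_nonneg _)
    have hk := hkey k
    have hMB : |sch.m r.curvature k / 6| - Bw ≤ C / x₀ := by
      by_cases hle : |sch.m r.curvature k / 6| - Bw ≤ 0
      · exact hle.trans (div_nonneg hC hx₀pos.le)
      · push Not at hle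
        rw [le_div_iff₀ hx₀pos]
        calc (|sch.m r.curvature k / 6| - Bw) * x₀
            ≤ (|sch.m r.curvature k / 6| - Bw) * (|sch.c r.curvature k| *
                (sch.a k ^ 4 * ∑ x ∈ box 4 (sch.L k), f (sch.a k • siteToE x))) :=
              mul_le_mul_of_nonneg_left hX hle.le
          _ = |sch.c r.curvature k| *
                (sch.a k ^ 4 * ∑ x ∈ box 4 (sch.L k), f (sch.a k • siteToE x)) *
                  (|sch.m r.curvature k / 6| - Bw) := by ring
          _ ≤ C := hk
    rw [abs_div, abs_of_pos (by norm_num : (0 : ℝ) < 6)] at hMB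
    linarith
  exact exists_forall_abs_le_of_eventually hevM

/-- **The two-point floor pins the multiplicative constant away from zero**: if
`δ ≤ |LS₂(u, v) − LS₁(u) LS₁(v)|` eventually with `δ > 0`, then `|c_k| ≥ √(δ/D) > 0` eventually
(`LatticeTruncatedTwoPointBound` and `exists_latticeSum_le` give `δ ≤ c_k² D`, `D = (2B_c)² C_u C_v`).
[folklore] -/
theorem eventually_le_abs_c_of_ntFloor (r : LatticeRep G) (sch : SpeciesScheme (YMSpecies G))
    (u v : 𝓢(EuclideanSpace ℝ (Fin 4), ℝ)) {δ : ℝ} (hδ : 0 < δ)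
    (hNT : ∀ᶠ k in atTop, δ ≤
      |latticeSchwinger r.ρ sch (fun s => s.F) k (1 + 1) (fun _ => r.curvature) ![u, v] -
        latticeSchwinger r.ρ sch (fun s => s.F) k 1 (fun _ => r.curvature) ![u] *
          latticeSchwinger r.ρ sch (fun s => s.F) k 1 (fun _ => r.curvature) ![v]|) :
    ∃ c₀ : ℝ, 0 < c₀ ∧ ∀ᶠ k in atTop, c₀ ≤ |sch.c r.curvature k| := by
  -- adapted from `stub_countertermBound` (PencilRigidityWeakCouplingHypercubicLimitStubCountertermBound.lean)
  obtain ⟨Bc, hBc⟩ := r.curvature.bounded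
  obtain ⟨Cu, hCu0, hCu⟩ := exists_latticeSum_le (d := 4) u
  obtain ⟨Cv, hCv0, hCv⟩ := exists_latticeSum_le (d := 4) v
  have hev_a : ∀ᶠ k in atTop, sch.a k ≤ 1 / 2 :=
    sch.tendsto_a.eventually (eventually_le_nhds (by norm_num))
  -- `δ ≤ c_k² D` eventually
  set D : ℝ := (2 * Bc) ^ 2 * Cu * Cv with hD_def
  have hevD : ∀ᶠ k in atTop, δ ≤ sch.c r.curvature k ^ 2 * D := by
    filter_upwards [hNT, hev_a] with k hk ha
    have ha1 : sch.a k ≤ 1 := ha.trans (by norm_num)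
    have h2 := LatticeTruncatedTwoPointBound G r sch r.curvature Bc hBc k ![u, v]
    have eu : (fun _ : Fin 1 => (![u, v] : Fin 2 → 𝓢(EuclideanSpace ℝ (Fin 4), ℝ)) 0) = ![u] :=
      funext fun i => by fin_cases i; rfl
    have ev : (fun _ : Fin 1 => (![u, v] : Fin 2 → 𝓢(EuclideanSpace ℝ (Fin 4), ℝ)) 1) = ![v] :=
      funext fun i => by fin_cases i; rfl
    rw [eu, ev] at h2
    simp only [Matrix.cons_val_zero, Matrix.cons_val_one] at h2
    have hRu := hCu (sch.a k) (sch.a_pos k) ha1 (sch.L k)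
    have hRv := hCv (sch.a k) (sch.a_pos k) ha1 (sch.L k)
    have h0 : 0 ≤ sch.c r.curvature k ^ 2 * (2 * Bc) ^ 2 := by positivity
    have hRv0 : 0 ≤ sch.a k ^ 4 * ∑ x ∈ box 4 (sch.L k), |v (sch.a k • siteToE x)| := by positivity
    calc δ ≤ _ := hk
      _ ≤ _ := h2
      _ ≤ sch.c r.curvature k ^ 2 * (2 * Bc) ^ 2 * Cu *
            (sch.a k ^ 4 * ∑ x ∈ box 4 (sch.L k), |v (sch.a k • siteToE x)|) :=
          mul_le_mul_of_nonneg_right (mul_le_mul_of_nonneg_left hRu h0) hRv0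
      _ ≤ sch.c r.curvature k ^ 2 * (2 * Bc) ^ 2 * Cu * Cv :=
          mul_le_mul_of_nonneg_left hRv (mul_nonneg h0 hCu0)
      _ = sch.c r.curvature k ^ 2 * D := by rw [hD_def]; ring
  have hD : 0 < D := by
    obtain ⟨k, hk⟩ := hevD.exists
    by_contra h
    push Not at h
    have : sch.c r.curvature k ^ 2 * D ≤ 0 := mul_nonpos_of_nonneg_of_nonpos (sq_nonneg _) h
    linarith
  refine ⟨Real.sqrt (δ / D), Real.sqrt_pos.2 (div_pos hδ hD), ?_⟩
  filter_upwards [hevD] with k hkD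
  calc Real.sqrt (δ / D) ≤ Real.sqrt (sch.c r.curvature k ^ 2) :=
        Real.sqrt_le_sqrt (by rw [div_le_iff₀ hD]; exact hkD)
    _ = |sch.c r.curvature k| := Real.sqrt_sq_eq_abs _

/-- **The third-cumulant floor pins the multiplicative constant away from zero**: if
`δ ≤ |LS₃(f,g,h) − LS₁(f)LS₂(g,h) − LS₁(g)LS₂(f,h) − LS₁(h)LS₂(f,g) + 2LS₁(f)LS₁(g)LS₁(h)|` eventually with
`δ > 0`, then `|c_k| ≥ min 1 (δ/D) > 0` eventually (`abs_conn_three_le` and `exists_latticeSum_le` give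
`δ ≤ |c_k|³ D`, `D = 6 (C_f B_c)(C_g B_c)(C_h B_c)`). [folklore] -/
theorem eventually_le_abs_c_of_skewFloor (r : LatticeRep G) (sch : SpeciesScheme (YMSpecies G))
    (f g h : 𝓢(EuclideanSpace ℝ (Fin 4), ℝ)) {δ : ℝ} (hδ : 0 < δ)
    (hSK : ∀ᶠ k in atTop, δ ≤
      |latticeSchwinger r.ρ sch (fun s => s.F) k 3 (fun _ => r.curvature) ![f, g, h] -
        latticeSchwinger r.ρ sch (fun s => s.F) k 1 (fun _ => r.curvature) ![f] *
          latticeSchwinger r.ρ sch (fun s => s.F) k 2 (fun _ => r.curvature) ![g, h] -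
        latticeSchwinger r.ρ sch (fun s => s.F) k 1 (fun _ => r.curvature) ![g] *
          latticeSchwinger r.ρ sch (fun s => s.F) k 2 (fun _ => r.curvature) ![f, h] -
        latticeSchwinger r.ρ sch (fun s => s.F) k 1 (fun _ => r.curvature) ![h] *
          latticeSchwinger r.ρ sch (fun s => s.F) k 2 (fun _ => r.curvature) ![f, g] +
        2 * (latticeSchwinger r.ρ sch (fun s => s.F) k 1 (fun _ => r.curvature) ![f] *
          latticeSchwinger r.ρ sch (fun s => s.F) k 1 (fun _ => r.curvature) ![g] *
          latticeSchwinger r.ρ sch (fun s => s.F) k 1 (fun _ => r.curvature) ![h])|) :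
    ∃ c₀ : ℝ, 0 < c₀ ∧ ∀ᶠ k in atTop, c₀ ≤ |sch.c r.curvature k| := by
  -- adapted from `stub_countertermBoundOfSkewFloor`
  -- (PencilRigidityWeakCouplingHypercubicLimitStubCountertermBoundOfSkewFloor.lean)
  obtain ⟨Bc, hBc⟩ := r.curvature.bounded
  have hBc0 : 0 ≤ Bc := (abs_nonneg _).trans (hBc fun _ => 1)
  obtain ⟨Cf, hCf0, hCf⟩ := exists_latticeSum_le (d := 4) f
  obtain ⟨Cg, hCg0, hCg⟩ := exists_latticeSum_le (d := 4) g
  obtain ⟨Ch, hCh0, hCh⟩ := exists_latticeSum_le (d := 4) h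
  have hev_a : ∀ᶠ k in atTop, sch.a k ≤ 1 / 2 :=
    sch.tendsto_a.eventually (eventually_le_nhds (by norm_num))
  -- `δ ≤ |c_k|³ D` eventually
  set D : ℝ := 6 * (Cf * Bc * (Cg * Bc) * (Ch * Bc)) with hD_def
  have hevD : ∀ᶠ k in atTop, δ ≤ |sch.c r.curvature k| ^ 3 * D := by
    filter_upwards [hSK, hev_a] with k hk ha
    have ha1 : sch.a k ≤ 1 := ha.trans (by norm_num)
    have hRf := hCf (sch.a k) (sch.a_pos k) ha1 (sch.L k)
    have hRg := hCg (sch.a k) (sch.a_pos k) ha1 (sch.L k)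
    have hRh := hCh (sch.a k) (sch.a_pos k) ha1 (sch.L k)
    have hmono : (sch.a k ^ 4 * ∑ x ∈ box 4 (sch.L k), |f (sch.a k • siteToE x)|) * Bc *
          ((sch.a k ^ 4 * ∑ x ∈ box 4 (sch.L k), |g (sch.a k • siteToE x)|) * Bc) *
          ((sch.a k ^ 4 * ∑ x ∈ box 4 (sch.L k), |h (sch.a k • siteToE x)|) * Bc) ≤
        Cf * Bc * (Cg * Bc) * (Ch * Bc) :=
      mul_le_mul (mul_le_mul (mul_le_mul_of_nonneg_right hRf hBc0)
        (mul_le_mul_of_nonneg_right hRg hBc0) (by positivity) (by positivity))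
        (mul_le_mul_of_nonneg_right hRh hBc0) (by positivity) (by positivity)
    calc δ ≤ _ := hk
      _ ≤ _ := abs_conn_three_le r sch hBc k f g h
      _ ≤ |sch.c r.curvature k| ^ 3 * D :=
          mul_le_mul_of_nonneg_left (mul_le_mul_of_nonneg_left hmono (by norm_num)) (by positivity)
  have hD : 0 < D := by
    obtain ⟨k, hk⟩ := hevD.exists
    by_contra hcon
    push Not at hcon
    have : |sch.c r.curvature k| ^ 3 * D ≤ 0 :=
      mul_nonpos_of_nonneg_of_nonpos (pow_nonneg (abs_nonneg _) 3) hcon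
    linarith
  refine ⟨min 1 (δ / D), lt_min one_pos (div_pos hδ hD), ?_⟩
  filter_upwards [hevD] with k hkD
  have h3 : δ / D ≤ |sch.c r.curvature k| ^ 3 := by rw [div_le_iff₀ hD]; exact hkD
  rcases le_or_gt 1 |sch.c r.curvature k| with h1 | h1
  · exact (min_le_left _ _).trans h1
  · exact (min_le_right _ _).trans
      (h3.trans (pow_le_of_le_one (abs_nonneg _) (le_of_lt h1) three_ne_zero))

end Lattice

/-! ## The two sub-goals -/

/-- **`countertermBound_of_momentOne_ntFloor` (line `Sketch`).** The `k`-uniform ORDER-ONE anisotropic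
moment bound and the two-point non-triviality floor force bounded additive counterterms of the curvature:
`∃ Cm, ∀ k, |m_k| ≤ Cm` (the floor pins `|c_k| ≥ c₀ > 0` eventually; the order-one bound on a non-negative
plateau bump on one plane pins `|c_k| (|m_k|/6 − B_w) ≤ 16 C/t`). [folklore] -/
theorem countertermBound_of_momentOne_ntFloor : ∀ (G : Type) [Group G] [TopologicalSpace G] [IsTopologicalGroup G] [CompactSpace G] [MeasurableSpace G] [BorelSpace G] (r : LatticeRep G) (sch : SpeciesScheme (YMSpecies G)), (∃ (s : ℕ) (C : ℝ), ∀ F : Plane → 𝓢(EuclideanSpace ℝ (Fin 4), ℝ), normP s F ≤ 1 → ∀ k : ℕ, |∫ U, fieldP r sch k F U ∂(wilsonAt r sch k)| ≤ C) → (∃ (u v : 𝓢(EuclideanSpace ℝ (Fin 4), ℝ)) (δ : ℝ), 0 < δ ∧ ∀ᶠ k in atTop, δ ≤ |latticeSchwinger r.ρ sch (fun s => s.F) k (1 + 1) (fun _ => r.curvature) ![u, v] - latticeSchwinger r.ρ sch (fun s => s.F) k 1 (fun _ => r.curvature) ![u] * latticeSchwinger r.ρ sch (fun s => s.F) k 1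 (fun _ => r.curvature) ![v]|) → ∃ Cm : ℝ, ∀ k, |sch.m r.curvature k| ≤ Cm := by
  intro G _ _ _ _ _ _ r sch hM hNT
  obtain ⟨s, C, hM⟩ := hM
  obtain ⟨u, v, δ, hδ, hNT⟩ := hNT
  obtain ⟨c₀, hc₀, hc⟩ := eventually_le_abs_c_of_ntFloor r sch u v hδ hNT
  exact countertermBound_of_cFloor r sch
    (fun q f hf k => abs_integral_planeField_le_of_momentOne r sch hM q hf k) hc₀ hc

/-- **`countertermBound_of_momentOne_skewFloor` (line `Sketch`).** The `k`-uniform ORDER-ONE anisotropic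
moment bound and the third-cumulant floor force bounded additive counterterms of the curvature:
`∃ Cm, ∀ k, |m_k| ≤ Cm` (the `κ₃` floor pins `|c_k| ≥ c₀ > 0` eventually, third cumulants of bounded
variables being bounded and scaling as `c_k³`; the order-one bound on a non-negative plateau bump on one plane
pins `|c_k| (|m_k|/6 − B_w) ≤ 16 C/t`). [folklore] -/
theorem countertermBound_of_momentOne_skewFloor : ∀ (G : Type) [Group G] [TopologicalSpace G] [IsTopologicalGroup G] [CompactSpace G] [MeasurableSpace G] [BorelSpace G] (r : LatticeRep G) (sch : SpeciesScheme (YMSpecies G)), (∃ (s : ℕ) (C : ℝ), ∀ F : Plane → 𝓢(EuclideanSpace ℝ (Fin 4), ℝ), normP s F ≤ 1 → ∀ k : ℕ, |∫ U, fieldP r sch k F U ∂(wilsonAt r sch k)| ≤ C) → (∃ (f g h : 𝓢(EuclideanSpace ℝ (Fin 4), ℝ)) (δ : ℝ), 0 < δ ∧ ∀ᶠ k in atTop, δ ≤ |latticeSchwinger r.ρ sch (fun s => s.F) k 3 (fun _ => r.curvature) ![f, g, h] - latticeSchwinger r.ρ sch (fun s => s.F) k 1 (fun _ => r.curvature) ![f]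 * latticeSchwinger r.ρ sch (fun s => s.F) k 2 (fun _ => r.curvature) ![g, h] - latticeSchwinger r.ρ sch (fun s => s.F) k 1 (fun _ => r.curvature) ![g] * latticeSchwinger r.ρ sch (fun s => s.F) k 2 (fun _ => r.curvature) ![f, h] - latticeSchwinger r.ρ sch (fun s => s.F) k 1 (fun _ => r.curvature) ![h] * latticeSchwinger r.ρ sch (fun s => s.F) k 2 (fun _ => r.curvature) ![f, g] + 2 * (latticeSchwinger r.ρ sch (fun s => s.F) k 1 (fun _ => r.curvature) ![f] * latticeSchwinger r.ρ sch (fun s => s.F) k 1 (fun _ => r.curvature) ![g] * latticeSchwinger r.ρ sch (fun s => s.F) k 1 (fun _ => r.curvature) ![h])|) → ∃ Cm : ℝ, ∀ k, |sch.m r.curvature k| ≤ Cm := by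
  intro G _ _ _ _ _ _ r sch hM hSK
  obtain ⟨s, C, hM⟩ := hM
  obtain ⟨f, g, h, δ, hδ, hSK⟩ := hSK
  obtain ⟨c₀, hc₀, hc⟩ := eventually_le_abs_c_of_skewFloor r sch f g h hδ hSK
  exact countertermBound_of_cFloor r sch
    (fun q p hp k => abs_integral_planeField_le_of_momentOne r sch hM q hp k) hc₀ hc

end Summit.QuantumFields.YangMills.Theorems.WeakCouplingHypercubicLimit.TraceNormColdPressure

end
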